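import Summits.NavierStokesRegularity.NavierStokesRegularity.Theses.AngularGalerkinLadder
import Summits.NavierStokesRegularity.NavierStokesRegularity.Theorems.NoOverheating.Negative.TransversalComponentsWindowsExcluded
import Literature.ModelTheory.ExponentialFields.RealClosedFieldTheory
import HarnessLib

/-!
# (S15)/(S16) along the precession axis: every window profile — and every witness of K1 — has an
# axis `e ≠ 0` of its own rotation, and relative to it BOTH the transversal velocity and the
# transversal vorticity are unbounded on every backward parabolic cylinder at the space–time origin

Refuter seat (ns-blowup-refuter g18), kernel census for crux K2 `NoOverheating`
(stmt-NavierStokesRegularity-19960) of route `AngularGalerkinLadder`, Negative lane (`--supports`).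
No definition, no named fact, no item verdict moves; nothing is asserted about Navier–Stokes.

The strata (S15)/(S16) of `TransversalComponentsWindowsExcluded` (KJ-55b) are stated relative to an
`R`-invariant line `ℝe`, `R e = e ∨ R e = −e`.  Such a line with `e ≠ 0` ALWAYS exists — Euler's
rotation theorem for `O(3)`: the characteristic polynomial of a linear isometry `R` of `ℝ³` is a
real cubic, so it has a real root `μ` (odd degree, intermediate value theorem — the tree's
`Real.exists_isRoot_of_odd_natDegree`), i.e. a real eigenvector `v ≠ 0`, `Rv = μv`, and
`‖Rv‖ = ‖v‖` forces `μ = ±1` (`exists_axis`).  Hence the census strata read, per profile and with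
no side condition left: for the axis `e` of its own rotation `R`,

* `windowProfile_transversal_unbounded_along_axis` — a window profile (`0 < δ`) has
  `sup_{Q_ρ(0,0)} dist(u, ℝe) = ∞` AND `sup_{Q_ρ(0,0)} dist(curl u, ℝe) = ∞` for every `ρ > 0`
  (in coordinates with `e = e₃`: `(u₁, u₂)` and `(ω₁, ω₂)` are both unbounded near the space–time
  origin);
* `rungProfile_transversal_unbounded_along_axis` — the same for every NONTRIVIAL rung profile
  (a witness of K1's `RungIsSingular L`).

References: [cite: BaeChoe2007CPDE, main theorem (two velocity components; quoted in Beirão da Veiga 2017, arXiv:1612.07051 p. 2)];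
[cite: ChaeChoe1999, Thm. 1 and Remark 1 (p. 2)]; [cite: BochnakCosteRoy1998, Ex. 1.2.3];
[cite: ArfkenWeber1995, §3.3 (orthogonal matrices; Euler's theorem on the rotation axis)].
-/

noncomputable section

namespace Summit.NavierStokesRegularity.AngularGalerkinLadderTransversalUnboundedAlongAxis

open Set Function Filter Topology Metric Module
open Literature.Analysis Literature.Analysis.FluidPDE
open Summit.NavierStokesRegularity.FluidComputer
open Summit.NavierStokesRegularity.FluidComputer.AngularLadder
open Summit.NavierStokesRegularity.NavierStokesRegularity.Theses.AngularGalerkinLadder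
open Summit.NavierStokesRegularity.AngularGalerkinLadderTransversalComponentsExcluded

/-! ### §1 Euler's rotation theorem for linear isometries of `ℝ³` -/

/-- **Euler's rotation theorem (sign-free form, all of `O(3)`)**: every linear isometry `R` of `ℝ³`
fixes some non-zero vector up to sign, `R e = e ∨ R e = −e` — a real root `μ` of the cubic
characteristic polynomial is an eigenvalue, and `‖R v‖ = ‖v‖` on an eigenvector gives `|μ| = 1`.
[cite: ArfkenWeber1995, §3.3 (orthogonal matrices; Euler's theorem on the rotation axis)] -/
theorem exists_axis (R : EuclideanSpace ℝ (Fin 3) ≃ₗᵢ[ℝ] EuclideanSpace ℝ (Fin 3)) :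
    ∃ e : EuclideanSpace ℝ (Fin 3), e ≠ 0 ∧ (R e = e ∨ R e = -e) := by
  set T : Module.End ℝ (EuclideanSpace ℝ (Fin 3)) := R.toLinearEquiv.toLinearMap with hT
  have hdeg : Odd T.charpoly.natDegree := by
    rw [LinearMap.charpoly_natDegree, finrank_euclideanSpace, Fintype.card_fin]
    exact ⟨1, by norm_num⟩
  obtain ⟨μ, hμ⟩ :=
    Literature.ModelTheory.ExponentialFields.Real.exists_isRoot_of_odd_natDegree hdeg
  have hev : T.HasEigenvalue μ := (Module.End.hasEigenvalue_iff_isRoot_charpoly T μ).2 hμ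
  obtain ⟨v, hv⟩ := hev.exists_hasEigenvector
  have hTv : R v = μ • v := by
    have := hv.apply_eq_smul
    simpa [hT] using this
  have hv0 : v ≠ 0 := hv.2
  have hμ1 : |μ| = 1 := by
    have h1 : ‖R v‖ = ‖v‖ := R.norm_map v
    rw [hTv, norm_smul, Real.norm_eq_abs] at h1
    exact (mul_left_eq_self₀.1 h1).resolve_right (norm_pos_iff.2 hv0).ne'
  refine ⟨v, hv0, ?_⟩
  rcases (abs_eq (zero_le_one)).1 hμ1 with h | h
  · left; rw [hTv, h, one_smul]
  · right; rw [hTv, h, neg_one_smul]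

/-! ### §2 The census strata (S15)/(S16) per profile, along its own axis -/

variable {L : ℕ} {C₀ cmin cmax δ ε c : ℝ}
  {R : EuclideanSpace ℝ (Fin 3) ≃ₗᵢ[ℝ] EuclideanSpace ℝ (Fin 3)}
  {u : ℝ → EuclideanSpace ℝ (Fin 3) → EuclideanSpace ℝ (Fin 3)}
  {p : ℝ → EuclideanSpace ℝ (Fin 3) → ℝ}
  {d : ℝ → EuclideanSpace ℝ (Fin 3) → EuclideanSpace ℝ (Fin 3)}

/-- **Every window profile has unbounded transversal velocity AND unbounded transversal vorticity,
relative to the axis of its own rotation, on every backward parabolic cylinder at the space–time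
origin.** [cite: BaeChoe2007CPDE, main theorem (two velocity components; quoted in Beirão da Veiga 2017, arXiv:1612.07051 p. 2)] -/
theorem windowProfile_transversal_unbounded_along_axis (hδ : 0 < δ)
    (hW : IsWindowProfile L C₀ cmin cmax δ ε c R u p d) :
    ∃ e : EuclideanSpace ℝ (Fin 3), e ≠ 0 ∧ (R e = e ∨ R e = -e) ∧
      (∀ ρ M : ℝ, 0 < ρ → ∃ z ∈ parabolicCylinder ρ (0 : ℝ × EuclideanSpace ℝ (Fin 3)),
        ∀ a : ℝ, M < ‖u z.1 z.2 - a • e‖) ∧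
      (∀ ρ M : ℝ, 0 < ρ → ∃ z ∈ parabolicCylinder ρ (0 : ℝ × EuclideanSpace ℝ (Fin 3)),
        ∀ a : ℝ, M < ‖curl (u z.1) z.2 - a • e‖) := by
  obtain ⟨e, he, hRe⟩ := exists_axis R
  refine ⟨e, he, hRe, fun ρ M hρ => ?_, fun ρ M hρ => ?_⟩
  · by_contra h
    push Not at h
    exact no_windowProfile_transversalVelocityBounded hδ hW hRe hρ h
  · by_contra h
    push Not at h
    exact no_windowProfile_transversalVorticityBounded hδ hW hRe hρ h

/-- **Every NONTRIVIAL rung profile (a witness of K1's `RungIsSingular L`) has unbounded transversal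
velocity and unbounded transversal vorticity, relative to the axis of its own rotation, on every
`Q_ρ(0,0)`.** [cite: ChaeChoe1999, Thm. 1 and Remark 1 (p. 2)] -/
theorem rungProfile_transversal_unbounded_along_axis (hP : IsRungProfile L C₀ c R u p d)
    (hnt : ∃ t < 0, ∃ x, u t x ≠ 0) :
    ∃ e : EuclideanSpace ℝ (Fin 3), e ≠ 0 ∧ (R e = e ∨ R e = -e) ∧
      (∀ ρ M : ℝ, 0 < ρ → ∃ z ∈ parabolicCylinder ρ (0 : ℝ × EuclideanSpace ℝ (Fin 3)),
        ∀ a : ℝ, M < ‖u z.1 z.2 - a • e‖) ∧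
      (∀ ρ M : ℝ, 0 < ρ → ∃ z ∈ parabolicCylinder ρ (0 : ℝ × EuclideanSpace ℝ (Fin 3)),
        ∀ a : ℝ, M < ‖curl (u z.1) z.2 - a • e‖) := by
  obtain ⟨e, he, hRe⟩ := exists_axis R
  refine ⟨e, he, hRe, fun ρ M hρ => ?_, fun ρ M hρ => ?_⟩
  · by_contra h
    push Not at h
    exact not_nontrivial_rungProfile_of_transversalVelocityBounded hP hRe hρ h hnt
  · by_contra h
    push Not at h
    exact not_nontrivial_rungProfile_of_transversalVorticityBounded hP hRe hρ h hnt

/-- **`RungIsSingular L` restated along the axis**: rung `L` is singular iff it carries a rung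
profile, nontrivial at some negative time, whose transversal velocity and vorticity relative to an
axis `e ≠ 0` of its rotation are unbounded on every `Q_ρ(0,0)` — the extra clauses cost nothing.
[cite: ChaeChoe1999, Thm. 1 and Remark 1 (p. 2)] -/
theorem rungIsSingular_iff_transversal_unbounded :
    RungIsSingular L ↔ ∃ (C₀ c : ℝ) (R : EuclideanSpace ℝ (Fin 3) ≃ₗᵢ[ℝ] EuclideanSpace ℝ (Fin 3))
      (u : ℝ → EuclideanSpace ℝ (Fin 3) → EuclideanSpace ℝ (Fin 3))
      (p : ℝ → EuclideanSpace ℝ (Fin 3) → ℝ)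
      (d : ℝ → EuclideanSpace ℝ (Fin 3) → EuclideanSpace ℝ (Fin 3)),
      IsRungProfile L C₀ c R u p d ∧ (∃ t < 0, ∃ x, u t x ≠ 0) ∧
      ∃ e : EuclideanSpace ℝ (Fin 3), e ≠ 0 ∧ (R e = e ∨ R e = -e) ∧
        (∀ ρ M : ℝ, 0 < ρ → ∃ z ∈ parabolicCylinder ρ (0 : ℝ × EuclideanSpace ℝ (Fin 3)),
          ∀ a : ℝ, M < ‖u z.1 z.2 - a • e‖) ∧
        (∀ ρ M : ℝ, 0 < ρ → ∃ z ∈ parabolicCylinder ρ (0 : ℝ × EuclideanSpace ℝ (Fin 3)),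
          ∀ a : ℝ, M < ‖curl (u z.1) z.2 - a • e‖) := by
  constructor
  · rintro ⟨C₀, c, R, u, p, d, hP, hnt⟩
    exact ⟨C₀, c, R, u, p, d, hP, hnt, rungProfile_transversal_unbounded_along_axis hP hnt⟩
  · rintro ⟨C₀, c, R, u, p, d, hP, hnt, -⟩
    exact ⟨C₀, c, R, u, p, d, hP, hnt⟩

end Summit.NavierStokesRegularity.AngularGalerkinLadderTransversalUnboundedAlongAxis

end
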